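import Summits.ResolutionOfSingularities.ResolutionOfSingularities.Theorems.PurelyInseparableDim4ResConeHeavyLetterSlices
import Summits.ResolutionOfSingularities.ResolutionOfSingularities.Theorems.PurelyInseparableDim4ResConeHasseContactStep
import Summits.ResolutionOfSingularities.ResolutionOfSingularities.Theorems.PurelyInseparableDim4ResConeCornerWalls
import Summits.ResolutionOfSingularities.ResolutionOfSingularities.Theorems.PurelyInseparableDim4Straightening
import HarnessLib

/-!
# Purely inseparable four-folds — L-LIGHT KILL, part F4: THE `x_ν`-SLICE POLYNOMIAL, ITS EXACT STEP LAW, ITS HASSE DERIVATIVES, AND THE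
# FREE-AXIS WITNESS (cell `res-dim4-pi`, K2(p) lane, the open loss-free `e = 3` cell; seat res-dim4-p-9 g6; HOME-only under desk R-251)

[OURS · counted 0]  Nothing here proves any TAIL(p, d, 3), K2(7), K2(p) or resolution of singularities in dimension ≥ 4 /
characteristic `p` — NOT proved.  One-step bookkeeping of OUR frame, cited by name from res-dim4-p-1 g7's `…HeavyLetterSlices` (slices
never mix / never cleaned), res-dim4-typ-1 g2's `…HasseBlowupCommute` (one-direction Hasse derivatives pass shears and chart maps) and the
CornerWalls witness lemmas.  AI kernel work, weaker than expert review.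

* §1 `coeff_slicePoly` — the `x_ν^v`-slice of `F` as a polynomial (a plain finite sum of its monomials; no definition is introduced).
* §2 **`slicePoly_step`** — for `ν ≠ j` untranslated and `p ∤ v`: the `v`-slice of the cleaned child `(step p univ j b s).F` IS the uncleaned
  transform `chartTransform p univ j (shear j b ·)` of the `v`-slice of `s.F` (exact polynomial identity; memo L-LIGHT-KILL-g6 §1).
* §3 `hasseDeriv_single_chartTransform_shear` (weight drop `q ↦ q − n` through the uncleaned transform), `coeff_hasseDeriv_single`.
* §4 `exists_free_axis_witness` — at an ISOLATED `p`-fold point some monomial has `E_A + E_B + E_ν < p` (CornerWalls, verbatim).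
[cite: Hauser2010, §§F–G, §I] [cite: HauserPerlega2019PRIMS, §2] [cite: EGAIV4, Thm. 16.11.2]
bears_on: LADDER-RESOLUTION:D157-DOOR2 (res-dim4-pi · K2(p) L-light cell · slice law).  Supports stmt-ResolutionOfSingularities-16155 (helper).
-/

set_option linter.dupNamespace false -- mandated namespace of this single-conjunct summit

noncomputable section

namespace Summit.ResolutionOfSingularities.ResolutionOfSingularities.Theorems.PIDim4

namespace ResCone

namespace LLight

open MvPolynomial Finset
open Literature.AlgebraicGeometry.Resolution
open Literature.AlgebraicGeometry.Resolution.CentreBlowup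
open Literature.AlgebraicGeometry.Resolution.Hauser2010

variable {K : Type} [Field K]

/-! ## 1. The slice polynomial -/

/-- **Coefficients of the `x_ν^v`-slice** `Σ_{E ∈ supp F, E_ν = v} coeff_E F · x^E`: `coeff_E` if `E_ν = v`, else `0`. [folklore] -/
theorem coeff_slicePoly (F : MvPolynomial (Fin 4) K) (ν : Fin 4) (v : ℕ) (E : Fin 4 →₀ ℕ) :
    coeff E (∑ d ∈ F.support with d ν = v, monomial d (coeff d F)) = if E ν = v then coeff E F else 0 := by
  classical
  rw [coeff_sum]
  simp only [coeff_monomial]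
  by_cases hE : E ν = v
  · rw [if_pos hE]
    by_cases hEs : E ∈ F.support
    · rw [Finset.sum_eq_single E (fun d _ hne => if_neg hne) (fun h => absurd (Finset.mem_filter.mpr ⟨hEs, hE⟩) h), if_pos rfl]
    · rw [Finset.sum_eq_zero fun d hd => ?_, MvPolynomial.notMem_support_iff.mp hEs]
      rw [if_neg]
      rintro rfl
      exact hEs (Finset.mem_filter.mp hd).1
  · rw [if_neg hE]
    exact Finset.sum_eq_zero fun d hd => if_neg fun h : d = E => hE (h ▸ (Finset.mem_filter.mp hd).2)

/-- Monomials of the slice are monomials of `F` in the slice. [folklore] -/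
theorem mem_support_slicePoly {F : MvPolynomial (Fin 4) K} {ν : Fin 4} {v : ℕ} {E : Fin 4 →₀ ℕ} :
    E ∈ (∑ d ∈ F.support with d ν = v, monomial d (coeff d F)).support ↔ E ∈ F.support ∧ E ν = v := by
  rw [MvPolynomial.mem_support_iff, coeff_slicePoly, MvPolynomial.mem_support_iff]
  constructor
  · intro h
    by_cases hE : E ν = v
    · rw [if_pos hE] at h; exact ⟨h, hE⟩
    · rw [if_neg hE] at h; exact absurd rfl h
  · rintro ⟨h, hE⟩; rwa [if_pos hE]

/-! ## 2. The exact step law of an uncleaned slice -/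

/-- **THE SLICE STEP LAW** (memo L-LIGHT-KILL-g6 §1): for a point step in chart `j ≠ ν` at a point `b` with `b_j = 0`, `b_ν = 0`
(`ν` untranslated) and `p ≤ ord F`, on a slice `p ∤ v` the slice of the CLEANED child is the UNCLEANED transform of the slice:
`slice_v ((step p univ j b s).F) = chartTransform p univ j (shear j b (slice_v s.F))`. [OURS over …HeavyLetterSlices §1]
[cite: Hauser2010, §§F–G] [cite: HauserPerlega2019PRIMS, §2] -/
theorem slicePoly_step [DecidableEq K] (p : ℕ) {j ν : Fin 4} (hνj : ν ≠ j) {b : Fin 4 → K} (hbj : b j = 0) (hbν : b ν = 0)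
    (s : State K) (hq : (p : ℕ∞) ≤ ordAlong Finset.univ s.F) {v : ℕ} (hv : ¬ p ∣ v) :
    (∑ d ∈ (CentreBlowup.step p Finset.univ j b s).F.support with d ν = v,
        monomial d (coeff d (CentreBlowup.step p Finset.univ j b s).F)) =
      chartTransform p Finset.univ j (shear j b (∑ d ∈ s.F.support with d ν = v, monomial d (coeff d s.F))) := by
  classical
  set G : MvPolynomial (Fin 4) K := ∑ d ∈ s.F.support with d ν = v, monomial d (coeff d s.F) with hG
  -- the slice state
  set sG : State K := ⟨G, s.r, s.exc⟩ with hsG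
  have hqG : (p : ℕ∞) ≤ ordAlong Finset.univ G := by
    refine le_ordAlong_of_forall fun d hd => ?_
    rw [hG, mem_support_slicePoly] at hd
    exact le_degree_of_mem_support hq hd.1 |>.trans_eq (degIn_univ d).symm
  have hpt : CentreBlowup.pointTransform p Finset.univ j b sG = chartTransform p Finset.univ j (shear j b G) :=
    Straightening.translate_chartTransform_univ_eq_chartTransform_shear p j b hbj G hqG
  rw [← hpt]
  ext D
  rw [coeff_slicePoly]
  by_cases hD : D ν = v
  · rw [if_pos hD, coeff_step_F_of_not_dvd p j b s (hD ▸ hv :  ¬ p ∣ D ν)]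
    exact coeff_pointTransform_eq_of_slice_eq p j b (t := sG) hνj hbν (e := v)
      (fun E hE => by rw [hsG]; simp only; rw [hG, coeff_slicePoly, if_pos hE]) hD
  · rw [if_neg hD, coeff_pointTransform_slice p j b sG hνj hbν D]
    symm
    refine Finset.sum_eq_zero fun E hE => ?_
    rw [Finset.mem_filter] at hE
    have hEs : E ∈ G.support := hE.1
    rw [hG, mem_support_slicePoly] at hEs
    exact absurd (hEs.2.symm.trans hE.2).symm hD

/-- The slice of `0`-free data: if the slice of `s.F` is `0`, so is the slice of the child (`ν ≠ j` untranslated, `p ∤ v`). [folklore] -/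
theorem slicePoly_step_eq_zero [DecidableEq K] (p : ℕ) {j ν : Fin 4} (hνj : ν ≠ j) {b : Fin 4 → K} (hbj : b j = 0) (hbν : b ν = 0)
    (s : State K) (hq : (p : ℕ∞) ≤ ordAlong Finset.univ s.F) {v : ℕ} (hv : ¬ p ∣ v)
    (h0 : (∑ d ∈ s.F.support with d ν = v, monomial d (coeff d s.F)) = 0) :
    (∑ d ∈ (CentreBlowup.step p Finset.univ j b s).F.support with d ν = v,
        monomial d (coeff d (CentreBlowup.step p Finset.univ j b s).F)) = 0 := by
  rw [slicePoly_step p hνj hbj hbν s hq hv, h0]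
  unfold shear
  rw [map_zero, chartTransform_zero]

/-! ## 3. One-direction Hasse derivatives through the uncleaned transform -/

/-- **`D_φ^{(n)}` passes the uncleaned transform with weight drop `q ↦ q − n`** (`φ ≠ j`, `n ≤ q`). [OURS over p677284]
[cite: EGAIV4, Thm. 16.11.2] -/
theorem hasseDeriv_single_chartTransform_shear {φ j : Fin 4} (hφj : φ ≠ j) {n q : ℕ} (hnq : n ≤ q) (b : Fin 4 → K)
    (G : MvPolynomial (Fin 4) K) :
    hasseDeriv (Finsupp.single φ n) (chartTransform q Finset.univ j (shear j b G)) =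
      chartTransform (q - n) Finset.univ j (shear j b (hasseDeriv (Finsupp.single φ n) G)) := by
  rw [hasseDeriv_single_chartTransform hφj hnq, hasseDeriv_single_shear hφj]

/-- **Coefficients of a one-direction Hasse derivative**: `coeff_E (D_φ^{(n)} G) = C(E_φ + n, n) · coeff_{E + n e_φ} G`. [folklore] -/
theorem coeff_hasseDeriv_single (φ : Fin 4) (n : ℕ) (G : MvPolynomial (Fin 4) K) (E : Fin 4 →₀ ℕ) :
    coeff E (hasseDeriv (Finsupp.single φ n) G) = ((E φ + n).choose n : K) * coeff (E + Finsupp.single φ n) G := by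
  rw [IsolatedBand.coeff_hasseDeriv, ← Finset.mul_prod_erase Finset.univ _ (Finset.mem_univ φ), Finsupp.single_eq_same,
    Finset.prod_eq_one fun i hi => ?_, mul_one]
  rw [Finsupp.single_eq_of_ne (Finset.ne_of_mem_erase hi), Nat.choose_zero_right, Nat.cast_one]

/-- Monomials of `D_φ^{(n)} G` are `E` with `E + n e_φ` a monomial of `G`. [folklore] -/
theorem add_single_mem_support_of_mem_support_hasseDeriv {φ : Fin 4} {n : ℕ} {G : MvPolynomial (Fin 4) K} {E : Fin 4 →₀ ℕ}
    (hE : E ∈ (hasseDeriv (Finsupp.single φ n) G).support) : E + Finsupp.single φ n ∈ G.support := by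
  rw [MvPolynomial.mem_support_iff, coeff_hasseDeriv_single] at hE
  exact MvPolynomial.mem_support_iff.mpr (right_ne_zero_of_mul hE)

/-! ## 4. The free-axis witness at an isolated point -/

/-- **FREE-AXIS WITNESS**: at an ISOLATED `p`-fold point, for any letter `φ` some monomial `E` of `F` has `Σ_{i ≠ φ} E_i < p` (the `x_φ`-axis is not
in the `p`-fold locus). [OURS = CornerWalls `ordAlong_erase_lt_of_isIsolated` + `exists_degIn_lt_of_ordAlong_lt`] [cite: HauserPerlega2019PRIMS, §2] -/
theorem exists_free_axis_witness {p : ℕ} {F : MvPolynomial (Fin 4) K} (hiso : IsIsolated p F) (φ : Fin 4) :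
    ∃ E ∈ F.support, degIn (Finset.univ.erase φ) E < p :=
  exists_degIn_lt_of_ordAlong_lt (ordAlong_erase_lt_of_isIsolated hiso φ)

/-- `Σ_{i ≠ φ} E_i` on four letters `{A, B, ν, φ}`. [folklore] -/
theorem degIn_erase_eq {A B ν φ : Fin 4} (hAB : A ≠ B) (hAν : A ≠ ν) (hAφ : A ≠ φ) (hBν : B ≠ ν) (hBφ : B ≠ φ) (hνφ : ν ≠ φ)
    (E : Fin 4 →₀ ℕ) : degIn (Finset.univ.erase φ) E = E A + E B + E ν := by
  unfold degIn
  have huniv : (Finset.univ.erase φ : Finset (Fin 4)) = {A, B, ν} := by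
    ext i
    simp only [Finset.mem_erase, Finset.mem_univ, and_true, Finset.mem_insert, Finset.mem_singleton]
    constructor
    · intro hi
      have hcard : ({A, B, ν, φ} : Finset (Fin 4)) = Finset.univ := by
        apply Finset.eq_univ_of_card
        rw [Finset.card_insert_of_notMem (by simp [hAB, hAν, hAφ]), Finset.card_insert_of_notMem (by simp [hBν, hBφ]),
          Finset.card_pair hνφ, Fintype.card_fin]
      have : i ∈ ({A, B, ν, φ} : Finset (Fin 4)) := hcard ▸ Finset.mem_univ i
      simp only [Finset.mem_insert, Finset.mem_singleton] at this
      tauto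
    · rintro (rfl | rfl | rfl)
      · exact hAφ
      · exact hBφ
      · exact hνφ
  rw [huniv, Finset.sum_insert (by simp [hAB, hAν]), Finset.sum_insert (by simp [hBν]), Finset.sum_singleton, add_assoc]

end LLight

end ResCone

end Summit.ResolutionOfSingularities.ResolutionOfSingularities.Theorems.PIDim4

end
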